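import Summits.CriticalPhenomena.PercolationContinuityZ3.Theorems.PercNearOneGluingAdditiveGluingBlockPeel
import HarnessLib

/-! # Crux `PercNearOneGluing.AdditiveGluing` (stmt-CriticalPhenomena-4576) — the finger multi-edge Lemma 3 in UNGLUED form:
# `stub_fingerML3_vp` is a set version of Kozma–Nitzan's Theorem 4 (seat (b) V⁺-form, depth prover `png-dp-vplus`)

Support file (`--supports stmt-CriticalPhenomena-4576`); no definitions, no named facts.  Companion of
`…AdditiveGluingBlockPeel.lean` (gluing push-forward `stub_gluePushforward`, `reachable_of_glue_of_avoids`) and of the registered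
open stub `stub_fingerML3_vp` (`…AdditiveGluingTFingers.lean`).

Setting of the stub: a weighting `K` on `Fin n`, relays `A`, a block `N` disjoint from `A`, the GLUED weighting `g = K/N` (weight `1` on
the non-loop pairs inside `N`), `R` = "some pair `N–A` is open", `U = ⋃_{v∈N} {v ↔ b}`, and the stub's target
`μ_g(R ∩ {d↔b}) ≤ μ_g(R ∩ U)` for `d ∉ N`.  Write `M = {d ↮ N}` ("the cluster of `d` avoids the block").

* `reachable_or_exists_mem_of_glue` — last-exit lemma: a vertex reachable from `u` after gluing `N` is reachable in `ω` itself
  from `u` or from some vertex of `N`; hence `U` is invariant under the gluing map (`glue_preimage_iUnion_openConn`), as are `R`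
  (`glue_preimage_contact`, the pairs `N–A` are not inner pairs) and `M` (`glue_preimage_avoids`).
* `finger_glued_gap_eq_unglued_gap` — **the identity**
  `μ_g(R ∩ U) − μ_g(R ∩ {d↔b}) = μ_K(R ∩ M ∩ U) − μ_K(R ∩ M ∩ {d↔b})`:
  off `M` the vertex `d` is attached to the block, and after gluing `{d↔b}` and `U` coincide there; on `M` gluing changes neither
  `{d↔b}` nor `U`.
* `fingerML3_iff_setForm`, `fingerML3_of_setForm` — consequently the stub (for every `|A|`, any block) is EQUIVALENT to an inequality
  about the single UNGLUED weighting `K`:  `μ_K(R ∩ {d↮N} ∩ {d↔b}) ≤ μ_K(R ∩ {d↮N} ∩ ⋃_{v∈N}{v↔b})`, i.e. "on the event that the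
  block has an open contact pair and the cluster of `d` avoids the block, the block beats `d`".  This statement makes sense for an
  ARBITRARY vertex set `N` of an arbitrary weighted graph; for `N = {v}` a single vertex it is exactly Kozma–Nitzan's Theorem 4
  (with `A = ` the neighbours of `v` together with `d`, `d` the minimiser), so the stub is a SET VERSION of that theorem, with the
  hypothesis `μ_K(d↔b) ≤ μ_K(a↔b)` read in the unglued weighting (Kozma–Nitzan's own hypothesis for the glued vertex fails by glue
  drift).  Depth-prover numerics (exact exhaustive censuses, n ≤ 6, 1.25 M hypothesis-satisfying multigraphs): 0 violations.
[cite: KozmaNitzan2024, Thm 4 (pp. 12–14), Lemma 5 (p. 13), §3.1 (gluing = probability 1), Question 9 (p. 36)]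
-/

namespace Summit.CriticalPhenomena.PercolationContinuityZ3.Theorems

open MeasureTheory Set
open Literature.Probability.LatticeModels (prodBernoulli)
open Literature.Probability.Percolation (BondConfig openConn openGraph)

noncomputable section
open Classical

section FingerSetForm

open Literature.Probability.LatticeModels Literature.Probability.Percolation

variable {n : ℕ}

/-- **Last exit from the block.**  If `y` is reachable from `u` after gluing `N` (adding all non-loop pairs inside `N`), then `y` is
reachable in `ω` itself from `u` or from some vertex of `N` (the last vertex of `N` on the walk). [folklore] -/
theorem reachable_or_exists_mem_of_glue {ω : BondConfig (Fin n)} (N : Finset (Fin n)) {u y : Fin n}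
    (h : (openGraph (ω ∪ {e : Sym2 (Fin n) | (∀ x ∈ e, x ∈ N) ∧ ¬ e.IsDiag} : BondConfig (Fin n))).Reachable u y) :
    (openGraph ω).Reachable u y ∨ ∃ v ∈ N, (openGraph ω).Reachable v y := by
  obtain ⟨p⟩ := h
  induction p with
  | nil => exact Or.inl (SimpleGraph.Reachable.refl _)
  | cons hadj q ih =>
    rename_i u' w' y'
    rcases ih with hw | ⟨v, hv, hvy⟩
    · obtain ⟨hmem, hne⟩ := (openGraph_adj _ u' w').1 hadj
      rcases hmem with hω | hD
      · exact Or.inl (((openGraph_adj ω u' w').2 ⟨hω, hne⟩).reachable.trans hw)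
      · exact Or.inr ⟨w', hD.1 w' (Sym2.mem_mk_right u' w'), hw⟩
    · exact Or.inr ⟨v, hv, hvy⟩

/-- Two vertices of the block are joined after gluing. [folklore] -/
theorem reachable_glue_of_mem {ω : BondConfig (Fin n)} (N : Finset (Fin n)) {x v : Fin n} (hx : x ∈ N) (hv : v ∈ N) :
    (openGraph (ω ∪ {e : Sym2 (Fin n) | (∀ x ∈ e, x ∈ N) ∧ ¬ e.IsDiag} : BondConfig (Fin n))).Reachable x v := by
  by_cases hxv : x = v
  · subst hxv
    exact SimpleGraph.Reachable.refl _
  · refine SimpleGraph.Adj.reachable ((openGraph_adj _ x v).2 ⟨Or.inr ⟨?_, ?_⟩, hxv⟩)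
    · intro y hy
      rcases Sym2.mem_iff.1 hy with rfl | rfl
      · exact hx
      · exact hv
    · rwa [Sym2.mk_isDiag_iff]

/-- `U = ⋃_{v∈N}{v↔b}` is invariant under gluing the block. [folklore] -/
theorem glue_preimage_iUnion_openConn (N : Finset (Fin n)) (b : Fin n) :
    {ω : BondConfig (Fin n) | (ω ∪ {e : Sym2 (Fin n) | (∀ x ∈ e, x ∈ N) ∧ ¬ e.IsDiag} : BondConfig (Fin n)) ∈
        ⋃ v ∈ N, (openConn v b : Set (BondConfig (Fin n)))} = ⋃ v ∈ N, openConn v b := by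
  ext ω
  simp only [Set.mem_setOf_eq, Set.mem_iUnion]
  constructor
  · rintro ⟨v, hv, hvb⟩
    rcases reachable_or_exists_mem_of_glue N hvb with h | ⟨v', hv', h'⟩
    · exact ⟨v, hv, h⟩
    · exact ⟨v', hv', h'⟩
  · rintro ⟨v, hv, hvb⟩
    exact ⟨v, hv, reachable_glue_mono N hvb⟩

/-- `R` = "some pair `N–A` is open" is invariant under gluing the block (`N`, `A` disjoint: contact pairs are not inner pairs).
[folklore] -/
theorem glue_preimage_contact (N A : Finset (Fin n)) (hNA : Disjoint N A) :
    {ω : BondConfig (Fin n) | (ω ∪ {e : Sym2 (Fin n) | (∀ x ∈ e, x ∈ N) ∧ ¬ e.IsDiag} : BondConfig (Fin n)) ∈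
        {ω' : Set (Sym2 (Fin n)) | ∃ v ∈ N, ∃ a ∈ A, s(v, a) ∈ ω'}} =
      {ω : Set (Sym2 (Fin n)) | ∃ v ∈ N, ∃ a ∈ A, s(v, a) ∈ ω} := by
  ext ω
  simp only [Set.mem_setOf_eq]
  constructor
  · rintro ⟨v, hv, a, ha, hva⟩
    rcases hva with hω | hD
    · exact ⟨v, hv, a, ha, hω⟩
    · exact (Finset.disjoint_left.1 hNA (hD.1 a (Sym2.mem_mk_right v a)) ha).elim
  · rintro ⟨v, hv, a, ha, hva⟩
    exact ⟨v, hv, a, ha, Or.inl hva⟩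

/-- `M = {d ↮ N}` is invariant under gluing the block. [folklore] -/
theorem glue_preimage_avoids (N : Finset (Fin n)) (d : Fin n) :
    {ω : BondConfig (Fin n) | (ω ∪ {e : Sym2 (Fin n) | (∀ x ∈ e, x ∈ N) ∧ ¬ e.IsDiag} : BondConfig (Fin n)) ∈
        {ω' : BondConfig (Fin n) | ∀ x ∈ (↑N : Set (Fin n)), ¬ (openGraph ω').Reachable d x}} =
      {ω : BondConfig (Fin n) | ∀ x ∈ (↑N : Set (Fin n)), ¬ (openGraph ω).Reachable d x} := by
  ext ω
  simp only [Set.mem_setOf_eq]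
  constructor
  · intro hM x hx hdx
    exact hM x hx (reachable_glue_mono N hdx)
  · intro hM x hx hdx
    exact hM x hx (reachable_of_glue_of_avoids hM hdx)

/-- **The glued gap is the unglued restricted gap.**  `g = K/N`, `R` = some pair `N–A` open, `U = ⋃_{v∈N}{v↔b}`, `M = {d ↮ N}`:
`μ_g(R ∩ U) − μ_g(R ∩ {d↔b}) = μ_K(R ∩ M ∩ U) − μ_K(R ∩ M ∩ {d↔b})`.  Off `M`, after gluing, `d` is attached to the block and
`{d↔b} = U`; on `M` the gluing changes neither event. [cite: KozmaNitzan2024, §3.1 (gluing), Thm 4 (pp. 12–14)] -/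
theorem finger_glued_gap_eq_unglued_gap (K : Sym2 (Fin n) → unitInterval) (A N : Finset (Fin n)) (d b : Fin n)
    (hNA : Disjoint N A) :
    (prodBernoulli (fun e' : Sym2 (Fin n) => if (∀ y ∈ e', y ∈ N) ∧ ¬ e'.IsDiag then 1 else K e')).real
        ({ω : Set (Sym2 (Fin n)) | ∃ v ∈ N, ∃ a ∈ A, s(v, a) ∈ ω} ∩ ⋃ v ∈ N, openConn v b) -
      (prodBernoulli (fun e' : Sym2 (Fin n) => if (∀ y ∈ e', y ∈ N) ∧ ¬ e'.IsDiag then 1 else K e')).real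
        ({ω : Set (Sym2 (Fin n)) | ∃ v ∈ N, ∃ a ∈ A, s(v, a) ∈ ω} ∩ openConn d b) =
    (prodBernoulli K).real
        ({ω : Set (Sym2 (Fin n)) | ∃ v ∈ N, ∃ a ∈ A, s(v, a) ∈ ω} ∩
          {ω : BondConfig (Fin n) | ∀ x ∈ (↑N : Set (Fin n)), ¬ (openGraph ω).Reachable d x} ∩ ⋃ v ∈ N, openConn v b) -
      (prodBernoulli K).real
        ({ω : Set (Sym2 (Fin n)) | ∃ v ∈ N, ∃ a ∈ A, s(v, a) ∈ ω} ∩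
          {ω : BondConfig (Fin n) | ∀ x ∈ (↑N : Set (Fin n)), ¬ (openGraph ω).Reachable d x} ∩ openConn d b) := by
  rw [stub_gluePushforward n K N, stub_gluePushforward n K N]
  set D : Set (Sym2 (Fin n)) := {e : Sym2 (Fin n) | (∀ x ∈ e, x ∈ N) ∧ ¬ e.IsDiag} with hD
  set M : Set (BondConfig (Fin n)) :=
    {ω : BondConfig (Fin n) | ∀ x ∈ (↑N : Set (Fin n)), ¬ (openGraph ω).Reachable d x} with hM
  set R : Set (BondConfig (Fin n)) := {ω : Set (Sym2 (Fin n)) | ∃ v ∈ N, ∃ a ∈ A, s(v, a) ∈ ω} with hR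
  set U : Set (BondConfig (Fin n)) := ⋃ v ∈ N, (openConn v b : Set (BondConfig (Fin n))) with hU
  have hmeas : ∀ s : Set (BondConfig (Fin n)), MeasurableSet s := fun _ => MeasurableSet.of_discrete
  -- the pull-backs
  have eR : ∀ ω : BondConfig (Fin n), (ω ∪ D : BondConfig (Fin n)) ∈ R ↔ ω ∈ R :=
    fun ω => Set.ext_iff.1 (glue_preimage_contact N A hNA) ω
  have eU : ∀ ω : BondConfig (Fin n), (ω ∪ D : BondConfig (Fin n)) ∈ U ↔ ω ∈ U :=
    fun ω => Set.ext_iff.1 (glue_preimage_iUnion_openConn N b) ω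
  have e1 : {ω : BondConfig (Fin n) | (ω ∪ D : BondConfig (Fin n)) ∈ R ∩ U} = R ∩ U := by
    ext ω
    simp only [Set.mem_setOf_eq, Set.mem_inter_iff]
    rw [eR ω, eU ω]
  -- `{ω | ω ∪ D ∈ R ∩ {d↔b}}` splits along `M`
  have e2 : {ω : BondConfig (Fin n) | (ω ∪ D : BondConfig (Fin n)) ∈ R ∩ openConn d b} ∩ M = R ∩ M ∩ openConn d b := by
    ext ω
    simp only [Set.mem_setOf_eq, Set.mem_inter_iff]
    constructor
    · rintro ⟨⟨hR', hdb'⟩, hωM⟩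
      exact ⟨⟨(eR ω).1 hR', hωM⟩, reachable_of_glue_of_avoids hωM hdb'⟩
    · rintro ⟨⟨hωR, hωM⟩, hdb⟩
      exact ⟨⟨(eR ω).2 hωR, reachable_glue_mono N (show (openGraph ω).Reachable d b from hdb)⟩, hωM⟩
  have e3 : {ω : BondConfig (Fin n) | (ω ∪ D : BondConfig (Fin n)) ∈ R ∩ openConn d b} \ M = (R ∩ U) \ M := by
    ext ω
    simp only [Set.mem_setOf_eq, Set.mem_sdiff, Set.mem_inter_iff]
    constructor
    · rintro ⟨⟨hR', hdb'⟩, hωM⟩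
      have hx : ∃ x ∈ (↑N : Set (Fin n)), (openGraph ω).Reachable d x := by
        by_contra hcon
        push Not at hcon
        exact hωM hcon
      obtain ⟨x, hxN, hdx⟩ := hx
      refine ⟨⟨(eR ω).1 hR', (eU ω).1 ?_⟩, hωM⟩
      exact Set.mem_iUnion₂.2 ⟨x, Finset.mem_coe.1 hxN, ((reachable_glue_mono N hdx).symm.trans hdb' :)⟩
    · rintro ⟨⟨hωR, hωU⟩, hωM⟩
      have hx : ∃ x ∈ (↑N : Set (Fin n)), (openGraph ω).Reachable d x := by
        by_contra hcon
        push Not at hcon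
        exact hωM hcon
      obtain ⟨x, hxN, hdx⟩ := hx
      obtain ⟨v, hv, hvb⟩ := Set.mem_iUnion₂.1 hωU
      refine ⟨⟨(eR ω).2 hωR, ?_⟩, hωM⟩
      have h1 : (openGraph (ω ∪ D : BondConfig (Fin n))).Reachable d x := reachable_glue_mono N hdx
      have h2 : (openGraph (ω ∪ D : BondConfig (Fin n))).Reachable x v :=
        reachable_glue_of_mem N (Finset.mem_coe.1 hxN) hv
      have h3 : (openGraph (ω ∪ D : BondConfig (Fin n))).Reachable v b := reachable_glue_mono N hvb
      exact (h1.trans h2).trans h3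
  have hs1 := measureReal_inter_add_sdiff (μ := prodBernoulli K)
    (s := {ω : BondConfig (Fin n) | (ω ∪ D : BondConfig (Fin n)) ∈ R ∩ openConn d b}) (hmeas M)
  have hs2 := measureReal_inter_add_sdiff (μ := prodBernoulli K) (s := R ∩ U) (hmeas M)
  have e4 : (R ∩ U) ∩ M = R ∩ M ∩ U := by
    ext ω
    simp only [Set.mem_inter_iff]
    tauto
  rw [e1, e2, e3] at *
  rw [e4] at hs2
  linarith

/-- **`stub_fingerML3_vp` ⟺ its unglued set form.**  With `g = K/N`, `R` = some pair `N–A` open, `U = ⋃_{v∈N}{v↔b}` and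
`M = {d ↮ N}`:  `μ_g(R ∩ {d↔b}) ≤ μ_g(R ∩ U)  ⟺  μ_K(R ∩ M ∩ {d↔b}) ≤ μ_K(R ∩ M ∩ U)`.  For `N = {v}` the right-hand side (given
the stub's hypothesis "`d` minimises `μ_K(·↔b)` over the contacts") is Kozma–Nitzan's Theorem 4; the stub is its set version.
[cite: KozmaNitzan2024, Thm 4 (pp. 12–14), §3.1, Question 9 (p. 36)] -/
theorem fingerML3_iff_setForm (K : Sym2 (Fin n) → unitInterval) (A N : Finset (Fin n)) (d b : Fin n)
    (hNA : Disjoint N A) :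
    (prodBernoulli (fun e' : Sym2 (Fin n) => if (∀ y ∈ e', y ∈ N) ∧ ¬ e'.IsDiag then 1 else K e')).real
        ({ω : Set (Sym2 (Fin n)) | ∃ v ∈ N, ∃ a ∈ A, s(v, a) ∈ ω} ∩ openConn d b) ≤
      (prodBernoulli (fun e' : Sym2 (Fin n) => if (∀ y ∈ e', y ∈ N) ∧ ¬ e'.IsDiag then 1 else K e')).real
        ({ω : Set (Sym2 (Fin n)) | ∃ v ∈ N, ∃ a ∈ A, s(v, a) ∈ ω} ∩ ⋃ v ∈ N, openConn v b) ↔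
    (prodBernoulli K).real
        ({ω : Set (Sym2 (Fin n)) | ∃ v ∈ N, ∃ a ∈ A, s(v, a) ∈ ω} ∩
          {ω : BondConfig (Fin n) | ∀ x ∈ (↑N : Set (Fin n)), ¬ (openGraph ω).Reachable d x} ∩ openConn d b) ≤
      (prodBernoulli K).real
        ({ω : Set (Sym2 (Fin n)) | ∃ v ∈ N, ∃ a ∈ A, s(v, a) ∈ ω} ∩
          {ω : BondConfig (Fin n) | ∀ x ∈ (↑N : Set (Fin n)), ¬ (openGraph ω).Reachable d x} ∩ ⋃ v ∈ N, openConn v b) := by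
  have h := finger_glued_gap_eq_unglued_gap K A N d b hNA
  constructor
  · intro hle
    linarith
  · intro hle
    linarith

/-- **FML3 from its unglued set form** (the direction a prover of the stub uses). [cite: KozmaNitzan2024, Thm 4 (pp. 12–14), §3.1] -/
theorem fingerML3_of_setForm (K : Sym2 (Fin n) → unitInterval) (A N : Finset (Fin n)) (d b : Fin n)
    (hNA : Disjoint N A)
    (hset : (prodBernoulli K).real
        ({ω : Set (Sym2 (Fin n)) | ∃ v ∈ N, ∃ a ∈ A, s(v, a) ∈ ω} ∩
          {ω : BondConfig (Fin n) | ∀ x ∈ (↑N : Set (Fin n)), ¬ (openGraph ω).Reachable d x} ∩ openConn d b) ≤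
      (prodBernoulli K).real
        ({ω : Set (Sym2 (Fin n)) | ∃ v ∈ N, ∃ a ∈ A, s(v, a) ∈ ω} ∩
          {ω : BondConfig (Fin n) | ∀ x ∈ (↑N : Set (Fin n)), ¬ (openGraph ω).Reachable d x} ∩ ⋃ v ∈ N, openConn v b)) :
    (prodBernoulli (fun e' : Sym2 (Fin n) => if (∀ y ∈ e', y ∈ N) ∧ ¬ e'.IsDiag then 1 else K e')).real
        ({ω : Set (Sym2 (Fin n)) | ∃ v ∈ N, ∃ a ∈ A, s(v, a) ∈ ω} ∩ openConn d b) ≤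
      (prodBernoulli (fun e' : Sym2 (Fin n) => if (∀ y ∈ e', y ∈ N) ∧ ¬ e'.IsDiag then 1 else K e')).real
        ({ω : Set (Sym2 (Fin n)) | ∃ v ∈ N, ∃ a ∈ A, s(v, a) ∈ ω} ∩ ⋃ v ∈ N, openConn v b) :=
  (fingerML3_iff_setForm K A N d b hNA).2 hset

end FingerSetForm

end

end Summit.CriticalPhenomena.PercolationContinuityZ3.Theorems
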